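import Summits.QuantumFields.QCD.Theorems.QuarksAsStableActionCriticalLineDiamagnetismRectFreqOpTransfer
import Summits.QuantumFields.QCD.Theorems.QuarksAsStableActionWilsonQuarkStabilityStubStaticSliceBoundAux
import Summits.QuantumFields.QCD.Theorems.QuarksAsStableActionWilsonQuarkStabilityStubReflectionStep
import Summits.QuantumFields.QCD.Theorems.QuarksAsStableActionWilsonQuarkStabilityStubChessboardOfReflection
import Summits.QuantumFields.QCD.Theorems.QuarksAsStableActionWilsonQuarkStabilityStubCyclicHolder
import Summits.QuantumFields.QCD.Theorems.QuarksAsStableActionWilsonQuarkStabilityStubNormDetChainBlock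

/-!
# Route B infrastructure for stub `stub_heavyFrequencyGain` of line `Sketch` — the static slice bound for the 2D frequency
determinant on RECTANGULAR two-tori `ℤ/L₁ × ℤ/L₂` along the first coordinate
(crux `Summit.QuantumFields.QCD.Theses.QuarksAsStableAction.CriticalLineDiamagnetism`, item stmt-QuantumFields-9734,
static route for odd tori, Route B of the heavy-frequency gain)

Two-length copy of `…StubFrequencyDiamagnetismAux3` (proofs kept parallel): from the rectangular transfer form
(`tfreqOpR_det_transfer_form`), the chain-block lemma `hE` and the cyclic Hölder / chessboard inequality `hH` on Fock space,
`‖det tfreqOpR A‖^{L₁} ≤ ∏_{s : ℤ/L₁} ‖det tfreqOpR (S_s A)‖` (`tfreqOpR_staticSliceBound`), where the static field `S_s A` reads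
the links along the second coordinate on row `s` and has trivial links along the first, and on the way the NORMAL FORM of the
static determinant `‖det tfreqOpR (S_s A)‖ = ‖det (A_sP⁻ − P⁺)‖^{L₁} · Re det(1 + M_s^{L₁})` (`norm_det_tfreqOpR_static`) — the
input of the slab pressures at all time lengths `L₁`.  The hypotheses are then DISCHARGED by the sibling crux's tree theorems
exactly as in `diamagnetic_odd` / `stub_frequencyDiamagnetism`: `hE` by `stub_normDetChainBlock` (any `L₁`:
`rectNormDetStatic`), `hH` by `stub_cyclicHolder` with `stub_reflectionStep`, `stub_chessboardOfReflection` (odd `L₁`: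
`rectStaticSliceBound`, registered, stated for `freqOpR euclideanGamma` through `det_tfreqOpR`).
References: M. Lüscher, Commun. Math. Phys. 54 (1977) 283; J. Fröhlich, R. Israel, E. H. Lieb, B. Simon, Commun. Math. Phys. 62
(1978) 1.
-/

noncomputable section

open scoped BigOperators Matrix ComplexConjugate Kronecker ComplexOrder
open Finset
open Literature.MathematicalPhysics.QuantumLattice Literature.MathematicalPhysics.QuantumFieldTheory
  Literature.Probability.LatticeModels

namespace Summit.QuantumFields.QCD.Cruxes.CriticalLineDiamagnetism.ChessboardCellGain

namespace FrequencyDiamagnetism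

open Matrix Complex
open Summit.QuantumFields.QCD.Cruxes.StableActionBridge.Sketch
open Summit.QuantumFields.QCD.Cruxes.WilsonQuarkStability.FreeTangentLandauChessboard

/-! ### The slice data as functions of the field -/

section Congr

variable {L₁ L₁' L₂ : ℕ} [NeZero L₂] (A : ZMod L₁ → ZMod L₂ → Fin 4 → Matrix.unitaryGroup (Fin 3) ℂ)
  (A' : ZMod L₁' → ZMod L₂ → Fin 4 → Matrix.unitaryGroup (Fin 3) ℂ) (m ω₀ ω₁ : ℝ) (t : ZMod L₁') (s : ZMod L₁)

omit [NeZero L₂] in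
/-- The hop of row `t` only sees the links `A(t,·,3)`. -/
theorem hop3R_congr (h : ∀ x, A' t x 3 = A s x 3) : hop3R A' t = hop3R A s := by
  simp only [hop3R, h]

omit [NeZero L₂] in
/-- The spin-blind slice operator of row `t` only sees the links `A(t,·,3)`. -/
theorem massHopR_congr (h : ∀ x, A' t x 3 = A s x 3) : massHopR A' m ω₀ ω₁ t = massHopR A m ω₀ ω₁ s := by
  rw [massHopR, massHopR, hop3R_congr A A' t s h]

omit [NeZero L₂] in
/-- The coefficients `C_{t,j}` only see the links `A(t,·,3)`. -/
theorem hopCoeffR_congr (h : ∀ x, A' t x 3 = A s x 3) : hopCoeffR A' ω₀ ω₁ t = hopCoeffR A ω₀ ω₁ s := by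
  rw [hopCoeffR, hopCoeffR, hop3R_congr A A' t s h]

/-- The slice operator of row `t` only sees the links `A(t,·,3)`. -/
theorem sliceOpR_congr (h : ∀ x, A' t x 3 = A s x 3) : sliceOpR A' m ω₀ ω₁ t = sliceOpR A m ω₀ ω₁ s := by
  rw [sliceOpR, sliceOpR, massHopR_congr A A' m ω₀ ω₁ t s h, hopCoeffR_congr A A' ω₀ ω₁ t s h]

/-- `B̂_t` only sees the links `A(t,·,3)`. -/
theorem sliceBhR_congr (h : ∀ x, A' t x 3 = A s x 3) : sliceBhR A' m ω₀ ω₁ t = sliceBhR A m ω₀ ω₁ s := by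
  rw [sliceBhR, sliceBhR, massHopR_congr A A' m ω₀ ω₁ t s h]

/-- The one-step matrix of row `t` only sees the links `A(t,·,3)`. -/
theorem oneStepR_congr (h : ∀ x, A' t x 3 = A s x 3) : oneStepR A' m ω₀ ω₁ t = oneStepR A m ω₀ ω₁ s := by
  rw [oneStepR, oneStepR, sliceOpR_congr A A' m ω₀ ω₁ t s h, sliceBhR_congr A A' m ω₀ ω₁ t s h]

omit [NeZero L₂] in
/-- With trivial links `A(t,·,2) = 1` the temporal transporters of row `t` are the signs `1` (off the seam) and `−1`
(on the seam `t = −1`). -/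
theorem link2R_of_apply_eq_one (h : ∀ x, A' t x 2 = 1) :
    ((t ≠ -1 → link2R A' t = 1) ∧ (t = -1 → link2R A' t = -1)) ∧ (link2R' A' t = 1 ∨ link2R' A' t = -1) := by
  by_cases ht : t = -1
  · refine ⟨⟨fun h' => absurd ht h', fun _ => ?_⟩, Or.inr ?_⟩
    · simp only [link2R, h, OneMemClass.coe_one]
      simp only [ht, if_true, neg_smul, one_smul]
      exact StaticSliceBound.colourLift_neg_one (ZMod L₂) 3
    · simp only [link2R', h, OneMemClass.coe_one, star_one]
      simp only [ht, if_true, neg_smul, one_smul]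
      exact StaticSliceBound.colourLift_neg_one (ZMod L₂) 3
  · refine ⟨⟨fun _ => ?_, fun h' => absurd h' ht⟩, Or.inl ?_⟩
    · simp only [link2R, h, ht, if_false, OneMemClass.coe_one, one_smul]
      exact StaticSliceBound.colourLift_one (ZMod L₂) 3
    · simp only [link2R', h, ht, if_false, OneMemClass.coe_one, star_one, one_smul]
      exact StaticSliceBound.colourLift_one (ZMod L₂) 3

omit [NeZero L₂] in
/-- The backward temporal transporter is the adjoint of the forward one. -/
theorem star_link2R' : star (link2R' A s) = link2R A s := by
  rw [Matrix.star_eq_conjTranspose]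
  ext ⟨x, c, α⟩ ⟨y, e, β⟩
  simp only [link2R, link2R', Matrix.conjTranspose_apply, Matrix.of_apply]
  by_cases hxy : x = y ∧ α = β
  · obtain ⟨rfl, rfl⟩ := hxy
    simp only [and_self, if_true, Matrix.smul_apply, smul_eq_mul, star_mul', star_seamSign, Matrix.star_apply,
      star_star]
  · rw [if_neg hxy, if_neg (fun h' => hxy ⟨h'.1.symm, h'.2.symm⟩), star_zero]

omit [NeZero L₂] in
/-- The frequency operator only reads the links along the two coordinates (`μ = 2, 3`). -/
theorem freqOpR_congr_links (g : Fin 4 → Matrix (Fin 4) (Fin 4) ℂ) (B : ZMod L₁ → ZMod L₂ → Fin 4 → Matrix.unitaryGroup (Fin 3) ℂ)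
    (h2 : ∀ t x, B t x 2 = A t x 2) (h3 : ∀ t x, B t x 3 = A t x 3) : freqOpR g B m ω₀ ω₁ = freqOpR g A m ω₀ ω₁ := by
  simp only [freqOpR, h2, h3]

end Congr

/-! ### The frequency determinant of a static field -/

/-- **The frequency determinant of a static field.**  For the static field `S_s A` (links `A(s,·,3)` on every row,
trivial links along the first coordinate), `‖det tfreqOpR (S_s A)‖ = ‖det (A_sP⁻ − P⁺)‖^{L₁} · Re det(1 + M_s^{L₁})` in terms of
the transfer data of `A`, given the chain-block lemma `hE`. -/
theorem norm_det_tfreqOpR_static {L₁ L₂ : ℕ} [NeZero L₁] [NeZero L₂]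
    (hE : ∀ {k : Type} [Fintype k] [DecidableEq k] (A Pp Pm W : Matrix k k ℂ),
      Pp + Pm = 1 → Pp * Pm = 0 → Pm * Pp = 0 → Ppᴴ = Pp → Pmᴴ = Pm →
      W ∈ Matrix.unitaryGroup k ℂ → W * Pp = Pp * W → W * Pm = Pm * W →
      ‖(A * Pm - Pp * W).det‖ = ‖(A * Pm - Pp).det‖)
    (A : ZMod L₁ → ZMod L₂ → Fin 4 → Matrix.unitaryGroup (Fin 3) ℂ) {m : ℝ} (hm : -1 < m) (ω₀ ω₁ : ℝ) (s : ZMod L₁) :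
    ‖(tfreqOpR (fun (_ : ZMod L₁) x μ => if μ = 3 then A s x 3 else 1) m ω₀ ω₁).det‖ =
      ‖(sliceOpR A m ω₀ ω₁ s * projM L₂ - projP L₂).det‖ ^ L₁ * ((1 + oneStepR A m ω₀ ω₁ s ^ L₁).det).re := by
  -- adapted from `StaticSliceBound.norm_det_wilsonDirac_static` (…WilsonQuarkStabilityStubStaticSliceBound.lean)
  have h3 : ∀ (t : ZMod L₁) (x : ZMod L₂), (fun (_ : ZMod L₁) (x : ZMod L₂) (μ : Fin 4) =>
      if μ = 3 then A s x 3 else (1 : Matrix.unitaryGroup (Fin 3) ℂ)) t x 3 = A s x 3 := fun t x => if_pos rfl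
  have h2 : ∀ (t : ZMod L₁) (x : ZMod L₂), (fun (_ : ZMod L₁) (x : ZMod L₂) (μ : Fin 4) =>
      if μ = 3 then A s x 3 else (1 : Matrix.unitaryGroup (Fin 3) ℂ)) t x 2 = 1 := fun t x => if_neg (by decide)
  obtain ⟨hdet, hMpos⟩ := tfreqOpR_det_transfer_form (L₁ := L₁) (fun (_ : ZMod L₁) x μ => if μ = 3 then A s x 3 else 1) hm ω₀ ω₁
  have hA : ∀ t, sliceOpR (fun (_ : ZMod L₁) x μ => if μ = 3 then A s x 3 else 1) m ω₀ ω₁ t = sliceOpR A m ω₀ ω₁ s := fun t =>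
    sliceOpR_congr A _ m ω₀ ω₁ t s (h3 t)
  have hM : ∀ t, oneStepR (fun (_ : ZMod L₁) x μ => if μ = 3 then A s x 3 else 1) m ω₀ ω₁ t = oneStepR A m ω₀ ω₁ s := fun t =>
    oneStepR_congr A _ m ω₀ ω₁ t s (h3 t)
  have hW := fun t : ZMod L₁ => link2R_of_apply_eq_one
    (fun (_ : ZMod L₁) (x : ZMod L₂) (μ : Fin 4) => if μ = 3 then A s x 3 else 1) t (h2 t)
  have hP : projP L₂ + projM L₂ = 1 := liftProjPlus_add_liftProjMinus (ZMod L₂) 3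
  have hPQ : projP L₂ * projM L₂ = 0 := liftProjPlus_mul_liftProjMinus (ZMod L₂) 3
  have hQP : projM L₂ * projP L₂ = 0 := liftProjMinus_mul_liftProjPlus (ZMod L₂) 3
  have hPph : (projP L₂)ᴴ = projP L₂ := (slice_claimsR A hm ω₀ ω₁ s).2.2.1
  have hPmh : (projM L₂)ᴴ = projM L₂ := (slice_claimsR A hm ω₀ ω₁ s).2.2.2.1
  have hblock : ∀ t, ‖(sliceOpR (fun (_ : ZMod L₁) x μ => if μ = 3 then A s x 3 else 1) m ω₀ ω₁ t * projM L₂ -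
      projP L₂ * link2R' (fun (_ : ZMod L₁) x μ => if μ = 3 then A s x 3 else 1) (t - 1)).det‖ =
      ‖(sliceOpR A m ω₀ ω₁ s * projM L₂ - projP L₂).det‖ := fun t => by
    obtain ⟨hu, hcp⟩ := StaticSliceBound.sign_unitary_comm _ (projP L₂) (hW (t - 1)).2
    obtain ⟨-, hcm⟩ := StaticSliceBound.sign_unitary_comm _ (projM L₂) (hW (t - 1)).2
    rw [hA t]
    exact hE _ _ _ _ hP hPQ hQP hPph hPmh hu hcp hcm
  have hprod : ((List.range L₁).map fun i : ℕ => oneStepR (fun (_ : ZMod L₁) x μ => if μ = 3 then A s x 3 else 1) m ω₀ ω₁ (i : ZMod L₁) *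
      link2R (fun (_ : ZMod L₁) x μ => if μ = 3 then A s x 3 else 1) (i : ZMod L₁)).prod = -(oneStepR A m ω₀ ω₁ s ^ L₁) := by
    have : (fun i : ℕ => oneStepR (fun (_ : ZMod L₁) x μ => if μ = 3 then A s x 3 else 1) m ω₀ ω₁ (i : ZMod L₁) *
        link2R (fun (_ : ZMod L₁) x μ => if μ = 3 then A s x 3 else 1) (i : ZMod L₁)) =
        fun i : ℕ => oneStepR A m ω₀ ω₁ s * link2R (fun (_ : ZMod L₁) x μ => if μ = 3 then A s x 3 else 1) (i : ZMod L₁) :=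
      funext fun i => by rw [hM]
    rw [this]
    exact StaticSliceBound.prod_map_range_sign (oneStepR A m ω₀ ω₁ s) _ (fun t => (hW t).1.1) (fun t => (hW t).1.2)
  have hMs : (oneStepR A m ω₀ ω₁ s).PosDef := hM 0 ▸ hMpos 0
  rw [hdet, norm_mul, norm_prod, Finset.prod_congr rfl fun t _ => hblock t, Finset.prod_const, Finset.card_univ,
    ZMod.card, hprod, sub_neg_eq_add, StaticSliceBound.norm_det_one_add_pow hMs]

/-! ### The static slice bound along the first coordinate -/

/-- **The static slice bound for the 2D frequency determinant along the first coordinate**: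
`‖det tfreqOpR A‖^{L₁} ≤ ∏_s ‖det tfreqOpR (S_s A)‖` for `m > −1`, given the cyclic Hölder inequality `hH` and the
chain-block lemma `hE` (the assembly of `stub_staticSliceBound` run on the time form). -/
theorem tfreqOpR_staticSliceBound {L₁ L₂ : ℕ} [NeZero L₁] [NeZero L₂]
    (hH : ∀ {k : Type} [Fintype k] [DecidableEq k] (T u : ZMod L₁ → Matrix k k ℂ),
      (∀ i, (T i).PosDef) → (∀ i, u i ∈ Matrix.unitaryGroup k ℂ) →
      ‖((List.range L₁).map fun i : ℕ => T (i : ZMod L₁) * u (i : ZMod L₁)).prod.trace‖ ^ L₁ ≤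
        ∏ i : ZMod L₁, ((T i) ^ L₁).trace.re)
    (hE : ∀ {k : Type} [Fintype k] [DecidableEq k] (A Pp Pm W : Matrix k k ℂ),
      Pp + Pm = 1 → Pp * Pm = 0 → Pm * Pp = 0 → Ppᴴ = Pp → Pmᴴ = Pm →
      W ∈ Matrix.unitaryGroup k ℂ → W * Pp = Pp * W → W * Pm = Pm * W →
      ‖(A * Pm - Pp * W).det‖ = ‖(A * Pm - Pp).det‖)
    (A : ZMod L₁ → ZMod L₂ → Fin 4 → Matrix.unitaryGroup (Fin 3) ℂ) {m : ℝ} (hm : -1 < m) (ω₀ ω₁ : ℝ) :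
    ‖(tfreqOpR A m ω₀ ω₁).det‖ ^ L₁ ≤
      ∏ s : ZMod L₁, ‖(tfreqOpR (fun (_ : ZMod L₁) x μ => if μ = 3 then A s x 3 else 1) m ω₀ ω₁).det‖ := by
  -- adapted from `stub_staticSliceBound` (…WilsonQuarkStabilityStubStaticSliceBound.lean)
  obtain ⟨hdet, hMpos⟩ := tfreqOpR_det_transfer_form A hm ω₀ ω₁
  have hP : projP L₂ + projM L₂ = 1 := liftProjPlus_add_liftProjMinus (ZMod L₂) 3
  have hPQ : projP L₂ * projM L₂ = 0 := liftProjPlus_mul_liftProjMinus (ZMod L₂) 3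
  have hQP : projM L₂ * projP L₂ = 0 := liftProjMinus_mul_liftProjPlus (ZMod L₂) 3
  have hPph : (projP L₂)ᴴ = projP L₂ := (slice_claimsR A hm ω₀ ω₁ 0).2.2.1
  have hPmh : (projM L₂)ᴴ = projM L₂ := (slice_claimsR A hm ω₀ ω₁ 0).2.2.2.1
  have hsp := fun t : ZMod L₁ => slice_spin_structureR A m ω₀ ω₁ t
  have hW'p : ∀ t, link2R' A t * projP L₂ = projP L₂ * link2R' A t := fun t => (hsp t).2.2.2.2.2.2.1
  have hW'm : ∀ t, link2R' A t * projM L₂ = projM L₂ * link2R' A t := fun t => (hsp t).2.2.2.2.2.2.2.1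
  have hW'W : ∀ t, link2R' A t * link2R A t = 1 := fun t => (hsp t).2.2.2.2.2.2.2.2
  have hW'u : ∀ t, link2R' A t ∈ Matrix.unitaryGroup _ ℂ := fun t =>
    Matrix.mem_unitaryGroup_iff.mpr (by rw [star_link2R', hW'W])
  have hWu : ∀ t, link2R A t ∈ Matrix.unitaryGroup _ ℂ := fun t => by
    rw [← star_link2R']
    exact Unitary.star_mem (hW'u t)
  have hEV : ∀ t, ‖(sliceOpR A m ω₀ ω₁ t * projM L₂ - projP L₂ * link2R' A (t - 1)).det‖ =
      ‖(sliceOpR A m ω₀ ω₁ t * projM L₂ - projP L₂).det‖ := fun t =>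
    hE _ _ _ _ hP hPQ hQP hPph hPmh (hW'u _) (hW'p _) (hW'm _)
  have hH' := StaticSliceBound.det_one_sub_prod_pow_le hH (oneStepR A m ω₀ ω₁) (link2R A) hMpos hWu
  have hstat := fun s : ZMod L₁ => norm_det_tfreqOpR_static hE A hm ω₀ ω₁ s
  rw [hdet, norm_mul, norm_prod, mul_pow, Finset.prod_congr rfl fun t _ => hEV t,
    Finset.prod_congr rfl fun s _ => hstat s, Finset.prod_mul_distrib, Finset.prod_pow]
  exact mul_le_mul_of_nonneg_left hH' (pow_nonneg (Finset.prod_nonneg fun _ _ => norm_nonneg _) _)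

end FrequencyDiamagnetism

/-! ### Discharge of the hypotheses: the registered theorem and the normal form -/

open Summit.QuantumFields.QCD.Cruxes.WilsonQuarkStability.FreeTangentLandauChessboard in
/-- **The normal form of the static rectangular frequency determinant** (any `L₁ ≥ 1`, `m > −1`):
`‖det tfreqOpR (S_s A)‖ = ‖det (A_sP⁻ − P⁺)‖^{L₁} · Re det(1 + M_s^{L₁})` with `A_s = sliceOpR A m ω₀ ω₁ s`,
`M_s = oneStepR A m ω₀ ω₁ s` — `norm_det_tfreqOpR_static` with the chain-block lemma discharged by `stub_normDetChainBlock`. -/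
theorem rectNormDetStatic {L₁ L₂ : ℕ} [NeZero L₁] [NeZero L₂]
    (A : ZMod L₁ → ZMod L₂ → Fin 4 → Matrix.unitaryGroup (Fin 3) ℂ) {m : ℝ} (hm : -1 < m) (ω₀ ω₁ : ℝ) (s : ZMod L₁) :
    ‖(FrequencyDiamagnetism.tfreqOpR (fun (_ : ZMod L₁) (x : ZMod L₂) (μ : Fin 4) => if μ = 3 then A s x 3 else 1)
        m ω₀ ω₁).det‖ =
      ‖(FrequencyDiamagnetism.sliceOpR A m ω₀ ω₁ s * FrequencyDiamagnetism.projM L₂ - FrequencyDiamagnetism.projP L₂).det‖ ^ L₁ *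
        ((1 + FrequencyDiamagnetism.oneStepR A m ω₀ ω₁ s ^ L₁).det).re :=
  FrequencyDiamagnetism.norm_det_tfreqOpR_static
    (fun A Pp Pm W hP hPQ hQP hPph hPmh hW hWp hWm => stub_normDetChainBlock A Pp Pm W hP hPQ hQP hPph hPmh hW hWp hWm)
    A hm ω₀ ω₁ s

open Summit.QuantumFields.QCD.Cruxes.WilsonQuarkStability.FreeTangentLandauChessboard in
/-- **Aux stub `rectStaticSliceBound`** (the static slice bound for the 2D frequency determinant on the rectangular two-torus
`ℤ/L₁ × ℤ/L₂` along the first coordinate, `L₁` ODD): for every field `A : ℤ/L₁ → ℤ/L₂ → Fin 4 → U(3)`, `m > −1` and real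
frequency pair, `‖det D[A]‖^{L₁} ≤ ∏_{s : ℤ/L₁} ‖det D[S_s A]‖` with the static field `S_s A` (links along the second coordinate read
on row `s`, trivial links along the first) — `tfreqOpR_staticSliceBound` with `hH` := `stub_cyclicHolder`
(`stub_reflectionStep`, `stub_chessboardOfReflection`; this is where `Odd L₁` enters) and `hE` := `stub_normDetChainBlock`,
transported to `freqOpR euclideanGamma` by `det_tfreqOpR`. -/
theorem rectStaticSliceBound : ∀ (L₁ L₂ : ℕ) [NeZero L₁] [NeZero L₂], Odd L₁ → ∀ (A : ZMod L₁ → ZMod L₂ → Fin 4 → Matrix.unitaryGroup (Fin 3) ℂ) (m : ℝ), -1 < m → ∀ ω₀ ω₁ : ℝ, ‖(FrequencyDiamagnetism.freqOpR euclideanGamma A m ω₀ ω₁).det‖ ^ L₁ ≤ ∏ s : ZMod L₁, ‖(FrequencyDiamagnetism.freqOpR euclideanGamma (fun (_ : ZMod L₁) (x : ZMod L₂) (μ : Fin 4) => if μ = 3 then A s x 3 else 1) m ω₀ ω₁).det‖ := by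
  intro L₁ L₂ _ _ hL A m hm ω₀ ω₁
  have h := FrequencyDiamagnetism.tfreqOpR_staticSliceBound
    (fun T u hT hu => stub_cyclicHolder
      (fun n T hT U hU e he ι hι c v => stub_reflectionStep n T hT U hU e he ι hι c v)
      (fun n F hF ν hν e ι hιe hrot hrefl hhom c v =>
        stub_chessboardOfReflection n F hF ν hν e ι hιe hrot hrefl hhom c v)
      hL T u hT hu)
    (fun A Pp Pm W hP hPQ hQP hPph hPmh hW hWp hWm => stub_normDetChainBlock A Pp Pm W hP hPQ hQP hPph hPmh hW hWp hWm)
    A hm ω₀ ω₁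
  simp only [FrequencyDiamagnetism.det_tfreqOpR] at h
  exact h

end Summit.QuantumFields.QCD.Cruxes.CriticalLineDiamagnetism.ChessboardCellGain

end
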